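import Mathlib
import HarnessLib
import Literature.MathematicalPhysics.QuantumLattice.HubbardMatsubaraTwoCutoffGram
import Literature.MathematicalPhysics.QuantumLattice.GrassmannEffectiveActionLipschitzDB
import Literature.MathematicalPhysics.QuantumLattice.GrassmannFlowIteration

/-!
# Route `KLProgramme` — ENGINE child `KLRegimeEngineV16` (stmt-HubbardSuperconductivity-20236), `stub_twoLeg_scale0`, conjunct (E3f-AT)₀,
# the CUTOFF leg `hcut` of `…KLRegimeSplit.twoLegVolumeRateAT_of_nestedLegs`: ONE sub-dyadic step `M ≤ M″ ≤ 2M` on the common `4M″` grid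
# (cell gate-hubbard-kl, seat hubbard-kl-k3c4-p2 g6; technique «Matsubara all-U route», route (C) of HOME/hubbard-kl-k3c4-p2/CUTOFF-EMBEDDING.md)

WHAT.  For the grid vertex `W = V_N + 𝒩_{K,N}` of the counterterm scheme on the `N = 4M″` time grid and the two scale-`Λ` grid covariances
`C″_g = S″ᵀC″^K_{>Λ}S″` (cutoff `M″`) and `C_g = SᵀC^K_{>Λ}S` (cutoff `M`, SAME grid), the two effective actions `G″_g = effAction C″_g W` and
`G_g = effAction C_g W` differ, in EVERY degree `m ≥ 1` and at every pinned leg, by at most `ρ_C^{-m}·e‖D‖_h/(1−θ_C)²`, where `D` is any profile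
dominating the near-identity output of the SHELL integration (`effAction S_g W − W`: tadpole `[m=2]·6t_e|U||β|/N` with the EQUAL-TIME shell entry
`t_e = c_eβ/(2π²M)`, plus `ρ_S^{-m}e‖W‖_{h_S}θ_S/(1−θ_S)`, `θ_S = e·α_S·‖W‖_{h_S}` at the `M`-uniform shell Gram constant `1`) and
`θ_C = e(α″ + α_S)(‖W‖_h + ‖D‖_h)/κ_C²`, `κ_C = √(2(8 + κ²))` (the `t`-uniform two-cutoff Gram constant of `HubbardMatsubaraTwoCutoffGram`):

* **`sum_norm_kernel_twoCutoff_effAction_sub_le`** — route (C): `C″_g = C_g + S_g` on one grid (`HubbardMatsubaraShellGrid`), so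
  `G″_g = effAction C_g W′`, `W′ = effAction S_g W` (semigroup); `W′ − W` is small in every degree by the time-local near-identity theorem
  `GrassmannNearIdentityStepLocal.sum_norm_kernel_effAction_sub_self_le_of_local` (every term carries the equal-time tadpole entry `O(β/M)` or a
  shell TREE line `(β/N)α_S = O(β/√M)`); and `V ↦ effAction C_g V` is Lipschitz in pinned `ℓ¹` kernel norms
  (`GrassmannEffectiveActionLipschitzDB.sum_norm_kernel_effAction_add_sub_le_of_gramBounded`, polarised cumulants) at the covariance `C_g`, which is
  replica-Gram-bounded with `κ_C` (`isGramBoundedR_gridSub_twoCutoff_dyadic` at `t = 0`) and has row sums `≤ α″ + α_S`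
  (`rowSum_gridSub_hubbardCovAboveCT_le_of_shell`).

All sizes (`α″, α_S`, the infrared constant `κ²`, the weights `ρ_S, ρ_C`, the two smallness conditions) are HYPOTHESES here; the sequel
(`…TwoCutoffScaleZeroLeg`) reads the two-leg kernel out into `klLocalPart … 0`, chains the sub-dyadic steps (`MatsubaraDyadicChaining`) and discharges
the sizes at the `klEng` thresholds.  Proof only; no definition; nothing about the model's physics is asserted beyond the stated inequality.
-/

noncomputable section

namespace Summit.HubbardSuperconductivity.HubbardSuperconductivity.Theorems.TwoVolumeDefect

set_option linter.dupNamespace false -- summit = problem name (single-conjunct summit), D-0017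

open Finset Literature.MathematicalPhysics.QuantumLattice Literature.Probability.LatticeModels GrassmannAlgebra

variable {L M M'' : ℕ} [NeZero L] [NeZero M'']

/-- Kernels are additive: `kernel (A − B) = kernel A − kernel B`. -/
private theorem kernel_sub_apply {Γ : Type*} [Fintype Γ] (A B : GrassmannAlgebra ℂ Γ) (m : ℕ) (X : Fin m → Γ) :
    kernel ℂ (A - B) m X = kernel ℂ A m X - kernel ℂ B m X := by
  rw [sub_eq_add_neg, kernel_add, ← neg_one_smul ℂ B, kernel_smul, neg_one_mul, ← sub_eq_add_neg]

/-- **ONE SUB-DYADIC STEP OF THE CUTOFF LEG AT SCALE `Λ` ON THE `4M″` GRID** (route (C): shell first, then the Lipschitz bound in the vertex).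
See the module docstring.  Hypotheses: `0 < β`, `1 ≤ M ≤ M″ ≤ 2M`, `0 < Λ ≤ π(2M+1)/β` (the shell floor), the infrared constant `κ²` of the
cutoff-`M″` weight, row/column bounds `α″` (cutoff-`M″` covariance) and `α_S` (shell) on the grid, weights `ρ_S, ρ_C > 0`, a profile `D ≥ 0`
dominating the near-identity output, and the two smallness conditions `θ_S < 1`, `θ_C < 1`.  Conclusion: in every degree `m ≥ 1`, at every pin,
`Σ_{X : X_i = w} ‖kernel (effAction C″_g W) m X − kernel (effAction C_g W) m X‖ ≤ ρ_C^{-m}·e‖D‖_h/(1 − θ_C)²`. -/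
theorem sum_norm_kernel_twoCutoff_effAction_sub_le {β : ℝ} (hβ : 0 < β) (hM : 1 ≤ M) (h : M ≤ M'') (hM2 : M'' ≤ 2 * M)
    (U μ : ℝ) (K : TrigPolyC4v) {Λ : ℝ} (hΛ : 0 < Λ) (hΛle : Λ ≤ Real.pi * (2 * M + 1) / β)
    {κ : ℝ}
    (hIR : 1 / (β * (L : ℝ) ^ 2) * ∑ k : FreqMomentum L M'',
        (1 - hubbardCutoffWeightCT L M'' β μ K Λ k) / Real.sqrt (matsubaraFreq β M'' k.1 ^ 2 + nambuXiCT L μ K k.2 ^ 2) ≤ κ ^ 2)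
    {aC aS : ℝ} (haC : 0 < aC) (haS : 0 < aS)
    (hrowC : ∀ X, ∑ Y, ‖((hubbardGridSub L M'' β (2 * (2 * M''))).transpose * hubbardCovAboveCT L M'' β μ 0 K Λ *
      hubbardGridSub L M'' β (2 * (2 * M''))) X Y‖ ≤ aC)
    (hcolC : ∀ Y, ∑ X, ‖((hubbardGridSub L M'' β (2 * (2 * M''))).transpose * hubbardCovAboveCT L M'' β μ 0 K Λ *
      hubbardGridSub L M'' β (2 * (2 * M''))) X Y‖ ≤ aC)
    (hrowS : ∀ X, ∑ Y, ‖((hubbardGridSub L M'' β (2 * (2 * M''))).transpose * hubbardCovShellCT L h β μ 0 K Λ *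
      hubbardGridSub L M'' β (2 * (2 * M''))) X Y‖ ≤ aS)
    (hcolS : ∀ Y, ∑ X, ‖((hubbardGridSub L M'' β (2 * (2 * M''))).transpose * hubbardCovShellCT L h β μ 0 K Λ *
      hubbardGridSub L M'' β (2 * (2 * M''))) X Y‖ ≤ aS)
    {ρS ρC : ℝ} (hρS : 0 < ρS) (hρC : 0 < ρC)
    (hθS : Real.exp 1 * aS * normV (GridLeg (GridPoint L (2 * (2 * M'')))) 1 ρS
        (fun m' => shellVertexProfile (2 * (2 * M'')) β U K (2 * m')) / 1 ^ 2 < 1)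
    (D : ℕ → ℝ) (hD0 : ∀ m, 0 ≤ D m)
    (hD : ∀ m, 0 < m →
      (if m = 2 then 6 * ((4 + |μ| + K.coeffNorm 0) * β / (2 * Real.pi ^ 2 * M)) * (|U| * |β| / (2 * (2 * M'') : ℕ)) else 0) +
        ρS⁻¹ ^ m * (Real.exp 1 * normV (GridLeg (GridPoint L (2 * (2 * M'')))) 1 ρS
            (fun m' => shellVertexProfile (2 * (2 * M'')) β U K (2 * m'))) *
          (Real.exp 1 * aS * normV (GridLeg (GridPoint L (2 * (2 * M'')))) 1 ρS
              (fun m' => shellVertexProfile (2 * (2 * M'')) β U K (2 * m')) / 1 ^ 2) /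
          (1 - Real.exp 1 * aS * normV (GridLeg (GridPoint L (2 * (2 * M'')))) 1 ρS
              (fun m' => shellVertexProfile (2 * (2 * M'')) β U K (2 * m')) / 1 ^ 2) ≤ D m)
    (hθC : Real.exp 1 * (aC + aS) *
        (normV (GridLeg (GridPoint L (2 * (2 * M'')))) (Real.sqrt (2 * (8 + κ ^ 2))) ρC
            (fun m' => shellVertexProfile (2 * (2 * M'')) β U K (2 * m')) +
          normV (GridLeg (GridPoint L (2 * (2 * M'')))) (Real.sqrt (2 * (8 + κ ^ 2))) ρC (fun m' => D (2 * m'))) /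
        Real.sqrt (2 * (8 + κ ^ 2)) ^ 2 < 1)
    {m : ℕ} (hm : 0 < m) (i : Fin m) (w : GridLeg (GridPoint L (2 * (2 * M'')))) :
    ∑ X ∈ univ.filter (fun X : Fin m → GridLeg (GridPoint L (2 * (2 * M''))) => X i = w),
        ‖kernel ℂ (effAction ℂ ((hubbardGridSub L M'' β (2 * (2 * M''))).transpose * hubbardCovAboveCT L M'' β μ 0 K Λ *
              hubbardGridSub L M'' β (2 * (2 * M'')))
            (hubbardGridInteraction L (2 * (2 * M'')) β U + hubbardGridCounterQuadratic L (2 * (2 * M'')) β K)) m X -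
          kernel ℂ (effAction ℂ ((hubbardGridSub L M β (2 * (2 * M''))).transpose * hubbardCovAboveCT L M β μ 0 K Λ *
              hubbardGridSub L M β (2 * (2 * M'')))
            (hubbardGridInteraction L (2 * (2 * M'')) β U + hubbardGridCounterQuadratic L (2 * (2 * M'')) β K)) m X‖ ≤
      ρC⁻¹ ^ m * (Real.exp 1 * normV (GridLeg (GridPoint L (2 * (2 * M'')))) (Real.sqrt (2 * (8 + κ ^ 2))) ρC (fun m' => D (2 * m'))) /
        (1 - Real.exp 1 * (aC + aS) *
          (normV (GridLeg (GridPoint L (2 * (2 * M'')))) (Real.sqrt (2 * (8 + κ ^ 2))) ρC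
              (fun m' => shellVertexProfile (2 * (2 * M'')) β U K (2 * m')) +
            normV (GridLeg (GridPoint L (2 * (2 * M'')))) (Real.sqrt (2 * (8 + κ ^ 2))) ρC (fun m' => D (2 * m'))) /
          Real.sqrt (2 * (8 + κ ^ 2)) ^ 2) ^ 2 := by
  -- notation
  set S'' := hubbardGridSub L M'' β (2 * (2 * M'')) with hS''
  set S := hubbardGridSub L M β (2 * (2 * M'')) with hS
  set Cg := S.transpose * hubbardCovAboveCT L M β μ 0 K Λ * S with hCg
  set C''g := S''.transpose * hubbardCovAboveCT L M'' β μ 0 K Λ * S'' with hC''g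
  set Sg := S''.transpose * hubbardCovShellCT L h β μ 0 K Λ * S'' with hSg
  set W := hubbardGridInteraction L (2 * (2 * M'')) β U + hubbardGridCounterQuadratic L (2 * (2 * M'')) β K with hW
  set κC : ℝ := Real.sqrt (2 * (8 + κ ^ 2)) with hκC
  haveI : NeZero (2 * (2 * M'')) := ⟨by have := NeZero.ne M''; omega⟩
  have hκC0 : 0 < κC := Real.sqrt_pos.2 (by positivity)
  -- the grid vertex: even, no constant part, time-local, profile
  have hWeven : W ∈ evenPart ℂ (GridLeg (GridPoint L (2 * (2 * M'')))) :=
    add_mem (hubbardGridInteraction_mem_evenPart β U) (hubbardGridCounterQuadratic_mem_evenPart_lit β K)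
  have hW0 : constPart ℂ W = 0 := by
    rw [hW, map_add, constPart_hubbardGridInteraction, constPart_hubbardGridCounterQuadratic, add_zero]
  have hloc : IsKernelLocal (SameTime (L := L) (N := 2 * (2 * M''))) W := isKernelLocal_sameTime_gridVertex β U K
  -- (1) the shell integration is a near-identity step, at the `M`-uniform Gram constant `1`
  set tE : ℝ := (4 + |μ| + K.coeffNorm 0) * β / (2 * Real.pi ^ 2 * M) with htE
  have htE0 : 0 ≤ tE := by rw [htE]; have := TrigPolyC4v.coeffNorm_nonneg 0 K; positivity
  have hGBS : IsGramBoundedR Sg 1 := by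
    rw [hSg, hS'', hubbardGridSub]; exact isGramBoundedR_gridSub_hubbardCovShellCT_one hβ h hM2 μ K Λ _ _
  have htS : ∀ A B : GridLeg (GridPoint L (2 * (2 * M''))), SameTime A B → ‖Sg A B‖ ≤ tE := fun A B hAB =>
    norm_gridSub_hubbardCovShellCT_le_of_sameTime hβ hM h μ K hΛ hΛle hAB
  obtain ⟨k, hk⟩ := isNilpotent_grassmannLaplacian ℂ Sg
  obtain ⟨hZS, hnear⟩ := sum_norm_kernel_effAction_sub_self_le_of_local Sg one_pos hGBS W hWeven hW0 hloc
    (shellVertexProfile (2 * (2 * M'')) β U K)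
    (shellVertexProfile_nonneg β U K) (sum_norm_kernel_gridVertex_le β U K) haS hrowS hcolS hρS hθS htE0 htS hk
  set W' := effAction ℂ Sg W with hW'
  -- (2) the defect `W′ − W`: even, no constant part, profile `D`
  have hW'even : W' ∈ evenPart ℂ (GridLeg (GridPoint L (2 * (2 * M'')))) := effAction_mem_evenPart Sg hWeven hW0
  have hDeven : W' - W ∈ evenPart ℂ (GridLeg (GridPoint L (2 * (2 * M'')))) := sub_mem hW'even hWeven
  have hD00 : constPart ℂ (W' - W) = 0 := by rw [map_sub, hW', constPart_effAction ℂ Sg W hZS, hW0, sub_zero]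
  have hDprof : ∀ m' (j : Fin (2 * m')) (w₀ : GridLeg (GridPoint L (2 * (2 * M'')))),
      ∑ Y ∈ univ.filter (fun Y : Fin (2 * m') → GridLeg (GridPoint L (2 * (2 * M''))) => Y j = w₀),
        ‖kernel ℂ (W' - W) (2 * m') Y‖ ≤ D (2 * m') := by
    intro m' j w₀
    rcases Nat.eq_zero_or_pos m' with rfl | hm'
    · exact Fin.elim0 (by simpa using j)
    · have hpos : 0 < 2 * m' := by omega
      have h1 := hnear hpos j w₀
      simp only [kernel_sub_apply]
      refine h1.trans ((sum_tadpole_shellVertexProfile_le β U K htE0 k hpos |> fun ht => add_le_add ht le_rfl).trans (hD (2 * m') hpos))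
  -- (3) the cutoff-`M` covariance on the `4M″` grid: Gram constant `κ_C` (t = 0), rows `≤ α″ + α_S`
  have hGBC : IsGramBoundedR Cg κC := by
    have h0 := isGramBoundedR_gridSub_twoCutoff_dyadic (L := L) hβ h hM2 μ K Λ (t := 0) le_rfl zero_le_one hIR
    rw [zero_smul, add_zero] at h0
    exact h0
  have hrowCg : ∀ X, ∑ Y, ‖Cg X Y‖ ≤ aC + aS := fun X => rowSum_gridSub_hubbardCovAboveCT_le_of_shell h β μ 0 K Λ hrowC hrowS X
  have hcolCg : ∀ Y, ∑ X, ‖Cg X Y‖ ≤ aC + aS := fun Y => colSum_gridSub_hubbardCovAboveCT_le_of_shell h β μ 0 K Λ hcolC hcolS Y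
  -- (4) the Lipschitz bound at `C_g` between `W` and `W′ = W + (W′ − W)`
  obtain ⟨_, _, hlip⟩ := sum_norm_kernel_effAction_add_sub_le_of_gramBounded Cg hκC0 hGBC W (W' - W) hWeven hDeven hW0 hD00
    (fun m' => shellVertexProfile (2 * (2 * M'')) β U K (2 * m')) (fun m' => D (2 * m')) (fun m' => shellVertexProfile_nonneg β U K _)
    (fun m' => hD0 _) (fun m' j w₀ => sum_norm_kernel_gridVertex_le β U K (2 * m') j w₀) hDprof (add_pos haC haS) hrowCg hcolCg hρC hθC
  -- (5) `G″_g = effAction C_g W′`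
  have htwo : effAction ℂ C''g W = effAction ℂ Cg W' := by
    rw [hC''g, hCg, hW', hSg, hS'', hS, hubbardGridSub, hubbardGridSub]
    exact effAction_gridSub_two_cutoffs h β μ 0 K Λ _ _ W hZS
  have hsum : W + (W' - W) = W' := add_sub_cancel W W'
  rw [hsum] at hlip
  have h := hlip hm i w
  rw [htwo]
  exact h

/-! ## §2 (appended) The same step with a PARAMETRIC vertex profile and equal-time entry (for the `FrameOK` sizes: position `ℓ¹` norm of the frame) -/

open scoped Nat

/-- **The pinned kernel norms of the grid vertex with the frame's POSITION `ℓ¹` NORM** (`|U||β|/N` in degree `4`,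
`(|β|/N)·Σ_z ‖Ǩ_L(z)‖` in degree `2`, `0` otherwise) — the profile the `FrameOK` sizes control
(`…EngineFramePosKernelPieces.sum_norm_framePosKernel_le_linear_of_frameOK`), replacing `coeffNorm 0 K` of `shellVertexProfile`. -/
theorem sum_norm_kernel_gridVertex_le_l1 {N : ℕ} (β U : ℝ) (K : TrigPolyC4v) (n : ℕ) (p : Fin n) (w : GridLeg (GridPoint L N)) :
    ∑ Z ∈ univ.filter (fun Z : Fin n → GridLeg (GridPoint L N) => Z p = w),
        ‖kernel ℂ (hubbardGridInteraction L N β U + hubbardGridCounterQuadratic L N β K) n Z‖ ≤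
      (if n = 4 then |U| * |β| / N else if n = 2 then |β| / N * ∑ z : TorusSite 2 L, ‖framePosKernel L K z‖ else 0) := by
  simp_rw [kernel_add]
  by_cases h4 : n = 4
  · subst h4
    rw [if_pos rfl]
    refine le_trans (sum_le_sum fun Z _ => ?_) (sum_norm_kernel_hubbardGridInteraction_le (L := L) (N := N) β U p w)
    rw [kernel_hubbardGridCounterQuadratic_of_ne β K (by norm_num) Z, add_zero]
  by_cases h2 : n = 2
  · subst h2
    rw [if_neg h4, if_pos rfl]
    refine le_trans (sum_le_sum fun Z _ => ?_) (sum_norm_kernel_hubbardGridCounterQuadratic_le_l1 (L := L) (N := N) β K p w)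
    rw [kernel_hubbardGridInteraction_of_ne (L := L) (N := N) β U (by norm_num) Z, zero_add]
  · rw [if_neg h4, if_neg h2]
    refine (sum_eq_zero fun Z _ => ?_).le
    rw [kernel_hubbardGridInteraction_of_ne (L := L) (N := N) β U h4 Z, kernel_hubbardGridCounterQuadratic_of_ne β K h2 Z, add_zero, norm_zero]

/-- The tadpole sum collapses for a profile supported in degrees `2` and `4`: only `(m, j) = (2, 1)` survives in degrees `m ≥ 1`. -/
theorem sum_tadpole_profile_le {n2 n4 t : ℝ} (hn4 : 0 ≤ n4) (ht : 0 ≤ t) (k : ℕ) {m : ℕ} (hm : 0 < m) :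
    ∑ j ∈ Ico 1 k, ((m + 2 * j)! : ℝ) / ((m ! : ℝ) * (j ! : ℝ) * 2 ^ j) * t ^ j *
        (if m + 2 * j = 4 then n4 else if m + 2 * j = 2 then n2 else 0) ≤
      if m = 2 then 6 * t * n4 else 0 := by
  have hterm : ∀ j ∈ Ico 1 k, ((m + 2 * j)! : ℝ) / ((m ! : ℝ) * (j ! : ℝ) * 2 ^ j) * t ^ j *
      (if m + 2 * j = 4 then n4 else if m + 2 * j = 2 then n2 else 0) = if j = 1 ∧ m = 2 then 6 * t * n4 else 0 := by
    intro j hj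
    have hj1 : 1 ≤ j := (mem_Ico.1 hj).1
    by_cases hjm : j = 1 ∧ m = 2
    · obtain ⟨rfl, rfl⟩ := hjm
      rw [if_pos (show (2 : ℕ) + 2 * 1 = 4 by norm_num), if_pos (show (1 : ℕ) = 1 ∧ (2 : ℕ) = 2 from ⟨rfl, rfl⟩)]
      norm_num [Nat.factorial]
    · rw [if_neg (show ¬(m + 2 * j = 4) by omega), if_neg (show ¬(m + 2 * j = 2) by omega), if_neg hjm, mul_zero]
  rw [sum_congr rfl hterm]
  by_cases hm2 : m = 2
  · subst hm2
    simp only [and_true, if_true]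
    rw [sum_ite_eq' (Ico 1 k) 1]
    split_ifs
    · exact le_rfl
    · positivity
  · simp only [hm2, and_false, if_false, sum_const_zero, le_refl]

/-- **ONE SUB-DYADIC STEP OF THE CUTOFF LEG, PARAMETRIC FORM** (the shape the `FrameOK`/`klEng` discharge consumes): as
`sum_norm_kernel_twoCutoff_effAction_sub_le`, but with the pinned profile of the grid vertex given by two numbers `n2, n4 ≥ 0` (degrees `2`, `4`;
e.g. `sum_norm_kernel_gridVertex_le_l1`) and the equal-time entries of the shell bounded by an arbitrary `tE ≥ 0`
(e.g. `HubbardMatsubaraShellBandL1.norm_gridSub_hubbardCovShellCT_le_of_sameTime_l1`): in every degree `m ≥ 1`, at every pin,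
`Σ‖kernel (effAction C″_g W) m − kernel (effAction C_g W) m‖ ≤ ρ_C^{-m}·e‖D‖_h/(1−θ_C)²` for any `D ≥ 0` dominating
`[m=2]·6·tE·n4 + ρ_S^{-m}·e‖W‖_{h_S}·θ_S/(1−θ_S)`, `θ_S = e·α_S·‖W‖_{h_S}` (shell Gram constant `1`), `θ_C = e(α″+α_S)(‖W‖_h+‖D‖_h)/(2(8+κ²))`. -/
theorem sum_norm_kernel_twoCutoff_effAction_sub_le_of_profile {β : ℝ} (hβ : 0 < β) (h : M ≤ M'') (hM2 : M'' ≤ 2 * M)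
    (U μ : ℝ) (K : TrigPolyC4v) (Λ : ℝ)
    {κ : ℝ}
    (hIR : 1 / (β * (L : ℝ) ^ 2) * ∑ k : FreqMomentum L M'',
        (1 - hubbardCutoffWeightCT L M'' β μ K Λ k) / Real.sqrt (matsubaraFreq β M'' k.1 ^ 2 + nambuXiCT L μ K k.2 ^ 2) ≤ κ ^ 2)
    {aC aS : ℝ} (haC : 0 < aC) (haS : 0 < aS)
    (hrowC : ∀ X, ∑ Y, ‖((hubbardGridSub L M'' β (2 * (2 * M''))).transpose * hubbardCovAboveCT L M'' β μ 0 K Λ *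
      hubbardGridSub L M'' β (2 * (2 * M''))) X Y‖ ≤ aC)
    (hcolC : ∀ Y, ∑ X, ‖((hubbardGridSub L M'' β (2 * (2 * M''))).transpose * hubbardCovAboveCT L M'' β μ 0 K Λ *
      hubbardGridSub L M'' β (2 * (2 * M''))) X Y‖ ≤ aC)
    (hrowS : ∀ X, ∑ Y, ‖((hubbardGridSub L M'' β (2 * (2 * M''))).transpose * hubbardCovShellCT L h β μ 0 K Λ *
      hubbardGridSub L M'' β (2 * (2 * M''))) X Y‖ ≤ aS)
    (hcolS : ∀ Y, ∑ X, ‖((hubbardGridSub L M'' β (2 * (2 * M''))).transpose * hubbardCovShellCT L h β μ 0 K Λ *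
      hubbardGridSub L M'' β (2 * (2 * M''))) X Y‖ ≤ aS)
    {tE : ℝ} (htE0 : 0 ≤ tE)
    (htE : ∀ A B : GridLeg (GridPoint L (2 * (2 * M''))), SameTime A B →
      ‖((hubbardGridSub L M'' β (2 * (2 * M''))).transpose * hubbardCovShellCT L h β μ 0 K Λ *
        hubbardGridSub L M'' β (2 * (2 * M''))) A B‖ ≤ tE)
    {n2 n4 : ℝ} (hn2 : 0 ≤ n2) (hn4 : 0 ≤ n4)
    (hNW : ∀ (n : ℕ) (p : Fin n) (w : GridLeg (GridPoint L (2 * (2 * M'')))),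
      ∑ Z ∈ univ.filter (fun Z : Fin n → GridLeg (GridPoint L (2 * (2 * M''))) => Z p = w),
        ‖kernel ℂ (hubbardGridInteraction L (2 * (2 * M'')) β U + hubbardGridCounterQuadratic L (2 * (2 * M'')) β K) n Z‖ ≤
          (if n = 4 then n4 else if n = 2 then n2 else 0))
    {ρS ρC : ℝ} (hρS : 0 < ρS) (hρC : 0 < ρC)
    (hθS : Real.exp 1 * aS * normV (GridLeg (GridPoint L (2 * (2 * M'')))) 1 ρS
        (fun m' => if 2 * m' = 4 then n4 else if 2 * m' = 2 then n2 else 0) / 1 ^ 2 < 1)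
    (D : ℕ → ℝ) (hD0 : ∀ m, 0 ≤ D m)
    (hD : ∀ m, 0 < m →
      (if m = 2 then 6 * tE * n4 else 0) +
        ρS⁻¹ ^ m * (Real.exp 1 * normV (GridLeg (GridPoint L (2 * (2 * M'')))) 1 ρS
            (fun m' => if 2 * m' = 4 then n4 else if 2 * m' = 2 then n2 else 0)) *
          (Real.exp 1 * aS * normV (GridLeg (GridPoint L (2 * (2 * M'')))) 1 ρS
              (fun m' => if 2 * m' = 4 then n4 else if 2 * m' = 2 then n2 else 0) / 1 ^ 2) /
          (1 - Real.exp 1 * aS * normV (GridLeg (GridPoint L (2 * (2 * M'')))) 1 ρS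
              (fun m' => if 2 * m' = 4 then n4 else if 2 * m' = 2 then n2 else 0) / 1 ^ 2) ≤ D m)
    (hθC : Real.exp 1 * (aC + aS) *
        (normV (GridLeg (GridPoint L (2 * (2 * M'')))) (Real.sqrt (2 * (8 + κ ^ 2))) ρC
            (fun m' => if 2 * m' = 4 then n4 else if 2 * m' = 2 then n2 else 0) +
          normV (GridLeg (GridPoint L (2 * (2 * M'')))) (Real.sqrt (2 * (8 + κ ^ 2))) ρC (fun m' => D (2 * m'))) /
        Real.sqrt (2 * (8 + κ ^ 2)) ^ 2 < 1)
    {m : ℕ} (hm : 0 < m) (i : Fin m) (w : GridLeg (GridPoint L (2 * (2 * M'')))) :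
    ∑ X ∈ univ.filter (fun X : Fin m → GridLeg (GridPoint L (2 * (2 * M''))) => X i = w),
        ‖kernel ℂ (effAction ℂ ((hubbardGridSub L M'' β (2 * (2 * M''))).transpose * hubbardCovAboveCT L M'' β μ 0 K Λ *
              hubbardGridSub L M'' β (2 * (2 * M'')))
            (hubbardGridInteraction L (2 * (2 * M'')) β U + hubbardGridCounterQuadratic L (2 * (2 * M'')) β K)) m X -
          kernel ℂ (effAction ℂ ((hubbardGridSub L M β (2 * (2 * M''))).transpose * hubbardCovAboveCT L M β μ 0 K Λ *
              hubbardGridSub L M β (2 * (2 * M'')))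
            (hubbardGridInteraction L (2 * (2 * M'')) β U + hubbardGridCounterQuadratic L (2 * (2 * M'')) β K)) m X‖ ≤
      ρC⁻¹ ^ m * (Real.exp 1 * normV (GridLeg (GridPoint L (2 * (2 * M'')))) (Real.sqrt (2 * (8 + κ ^ 2))) ρC (fun m' => D (2 * m'))) /
        (1 - Real.exp 1 * (aC + aS) *
          (normV (GridLeg (GridPoint L (2 * (2 * M'')))) (Real.sqrt (2 * (8 + κ ^ 2))) ρC
              (fun m' => if 2 * m' = 4 then n4 else if 2 * m' = 2 then n2 else 0) +
            normV (GridLeg (GridPoint L (2 * (2 * M'')))) (Real.sqrt (2 * (8 + κ ^ 2))) ρC (fun m' => D (2 * m'))) /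
          Real.sqrt (2 * (8 + κ ^ 2)) ^ 2) ^ 2 := by
  -- notation
  set S'' := hubbardGridSub L M'' β (2 * (2 * M'')) with hS''
  set S := hubbardGridSub L M β (2 * (2 * M'')) with hS
  set Cg := S.transpose * hubbardCovAboveCT L M β μ 0 K Λ * S with hCg
  set C''g := S''.transpose * hubbardCovAboveCT L M'' β μ 0 K Λ * S'' with hC''g
  set Sg := S''.transpose * hubbardCovShellCT L h β μ 0 K Λ * S'' with hSg
  set W := hubbardGridInteraction L (2 * (2 * M'')) β U + hubbardGridCounterQuadratic L (2 * (2 * M'')) β K with hW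
  set prof : ℕ → ℝ := fun n => if n = 4 then n4 else if n = 2 then n2 else 0 with hprof
  set κC : ℝ := Real.sqrt (2 * (8 + κ ^ 2)) with hκC
  haveI : NeZero (2 * (2 * M'')) := ⟨by have := NeZero.ne M''; omega⟩
  have hκC0 : 0 < κC := Real.sqrt_pos.2 (by positivity)
  have hprof0 : ∀ n, 0 ≤ prof n := fun n => by simp only [hprof]; split_ifs <;> positivity
  have hprofW : ∀ (n : ℕ) (p : Fin n) (w : GridLeg (GridPoint L (2 * (2 * M'')))),
      ∑ Z ∈ univ.filter (fun Z : Fin n → GridLeg (GridPoint L (2 * (2 * M''))) => Z p = w), ‖kernel ℂ W n Z‖ ≤ prof n := hNW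
  -- the grid vertex: even, no constant part, time-local
  have hWeven : W ∈ evenPart ℂ (GridLeg (GridPoint L (2 * (2 * M'')))) :=
    add_mem (hubbardGridInteraction_mem_evenPart β U) (hubbardGridCounterQuadratic_mem_evenPart_lit β K)
  have hW0 : constPart ℂ W = 0 := by
    rw [hW, map_add, constPart_hubbardGridInteraction, constPart_hubbardGridCounterQuadratic, add_zero]
  have hloc : IsKernelLocal (SameTime (L := L) (N := 2 * (2 * M''))) W := isKernelLocal_sameTime_gridVertex β U K
  -- (1) the shell integration is a near-identity step, at the `M`-uniform Gram constant `1`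
  have hGBS : IsGramBoundedR Sg 1 := by
    rw [hSg, hS'', hubbardGridSub]; exact isGramBoundedR_gridSub_hubbardCovShellCT_one hβ h hM2 μ K Λ _ _
  obtain ⟨k, hk⟩ := isNilpotent_grassmannLaplacian ℂ Sg
  obtain ⟨hZS, hnear⟩ := sum_norm_kernel_effAction_sub_self_le_of_local Sg one_pos hGBS W hWeven hW0 hloc prof hprof0 hprofW
    haS hrowS hcolS hρS hθS htE0 htE hk
  set W' := effAction ℂ Sg W with hW'
  -- (2) the defect `W′ − W`: even, no constant part, profile `D`
  have hW'even : W' ∈ evenPart ℂ (GridLeg (GridPoint L (2 * (2 * M'')))) := effAction_mem_evenPart Sg hWeven hW0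
  have hDeven : W' - W ∈ evenPart ℂ (GridLeg (GridPoint L (2 * (2 * M'')))) := sub_mem hW'even hWeven
  have hD00 : constPart ℂ (W' - W) = 0 := by rw [map_sub, hW', constPart_effAction ℂ Sg W hZS, hW0, sub_zero]
  have htad : ∀ {m : ℕ}, 0 < m → ∑ j ∈ Ico 1 k, ((m + 2 * j)! : ℝ) / ((m ! : ℝ) * (j ! : ℝ) * 2 ^ j) * tE ^ j * prof (m + 2 * j) ≤
      if m = 2 then 6 * tE * n4 else 0 := fun {m} hm => by
    simp only [hprof]
    exact sum_tadpole_profile_le hn4 htE0 k hm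
  have hDprof : ∀ m' (j : Fin (2 * m')) (w₀ : GridLeg (GridPoint L (2 * (2 * M'')))),
      ∑ Y ∈ univ.filter (fun Y : Fin (2 * m') → GridLeg (GridPoint L (2 * (2 * M''))) => Y j = w₀),
        ‖kernel ℂ (W' - W) (2 * m') Y‖ ≤ D (2 * m') := by
    intro m' j w₀
    rcases Nat.eq_zero_or_pos m' with rfl | hm'
    · exact Fin.elim0 (by simpa using j)
    · have hpos : 0 < 2 * m' := by omega
      have h1 := hnear hpos j w₀
      simp only [kernel_sub_apply]
      exact h1.trans ((add_le_add (htad hpos) le_rfl).trans (hD (2 * m') hpos))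
  -- (3) the cutoff-`M` covariance on the `4M″` grid: Gram constant `κ_C` (t = 0), rows `≤ α″ + α_S`
  have hGBC : IsGramBoundedR Cg κC := by
    have h0 := isGramBoundedR_gridSub_twoCutoff_dyadic (L := L) hβ h hM2 μ K Λ (t := 0) le_rfl zero_le_one hIR
    rw [zero_smul, add_zero] at h0
    exact h0
  have hrowCg : ∀ X, ∑ Y, ‖Cg X Y‖ ≤ aC + aS := fun X => rowSum_gridSub_hubbardCovAboveCT_le_of_shell h β μ 0 K Λ hrowC hrowS X
  have hcolCg : ∀ Y, ∑ X, ‖Cg X Y‖ ≤ aC + aS := fun Y => colSum_gridSub_hubbardCovAboveCT_le_of_shell h β μ 0 K Λ hcolC hcolS Y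
  -- (4) the Lipschitz bound at `C_g` between `W` and `W′ = W + (W′ − W)`
  obtain ⟨_, _, hlip⟩ := sum_norm_kernel_effAction_add_sub_le_of_gramBounded Cg hκC0 hGBC W (W' - W) hWeven hDeven hW0 hD00
    (fun m' => prof (2 * m')) (fun m' => D (2 * m')) (fun m' => hprof0 _)
    (fun m' => hD0 _) (fun m' j w₀ => hprofW (2 * m') j w₀) hDprof (add_pos haC haS) hrowCg hcolCg hρC hθC
  -- (5) `G″_g = effAction C_g W′`
  have htwo : effAction ℂ C''g W = effAction ℂ Cg W' := by
    rw [hC''g, hCg, hW', hSg, hS'', hS, hubbardGridSub, hubbardGridSub]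
    exact effAction_gridSub_two_cutoffs h β μ 0 K Λ _ _ W hZS
  have hsum : W + (W' - W) = W' := add_sub_cancel W W'
  rw [hsum] at hlip
  have h := hlip hm i w
  rw [htwo]
  exact h

end Summit.HubbardSuperconductivity.HubbardSuperconductivity.Theorems.TwoVolumeDefect

end
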